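import Mathlib
import Literature.Analysis.Calculus.SmoothCutoff

/-!
# THE BAND LAW, part A: the band test function `u = ψ · φ((F − a)/(b − a))` and its gradient
# (plate t39b-A of ROUND-38 «the waiting-time exponent», kernel of «Lemma K without symmetry»;
# crux E `PowerGaugeEulerLiouville`, stmt-NavierStokesRegularity-19832)

LANDING PLATE prepared by nsreg-p2 g33 (cell ns-regularity-ideate, TEXT custody DIRECTOR-NS #199 (1)) for a
keyed PROVER hand (`--supports stmt-NavierStokesRegularity-19832 --as helper`); the planner lands nothing.
Mathlib only.  KERNEL STATEMENTS ONLY — no Euler / Navier–Stokes content.  Part B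
(`…NeedleBandLaw.lean`) turns the gradient bound of this file into the ONE-BAND LAW and the BAND DECAY via the
planar Gagliardo–Nirenberg–Sobolev inequality.

CONTENT.  `φ = Real.smoothTransition` (the clamp): its derivative vanishes off `(0,1)` (Fermat) and is
globally bounded by `clampBound`.  `ψ = radialCutoff r₁ r₂` = `φ((r₂² − ‖z‖²)/(r₂² − r₁²))`: smooth, `= 1` on
`‖z‖ ≤ r₁`, `= 0` on `‖z‖ ≥ r₂`, `‖∇ψ‖ ≤ 2M/(r₂ − r₁)`.  For `F : ℂ → ℝ` continuous, `C¹` on `ball 0 r ⊃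
closedBall 0 r₂`, and levels `a < b`, the band test function `u = bandTest F a b r₁ r₂ = ψ · φ((F − a)/(b − a))`
is `C¹` with compact support, `= 1` on `{‖z‖ ≤ r₁, F ≥ b}`, and (THE point, `norm_fderiv_bandTest_le`)
`‖∇u‖ ≤ (2M/(r₂ − r₁)) · 𝟙{‖z‖ < r₂, F > a} + (M/(b − a)) · ‖F'‖ · 𝟙{‖z‖ < r₂, a < F < b}` — the gradient of
`u` lives on ONE level band.  WHAT THIS IS NOT: not crux E; no statement about profiles.
[Fermat's stationary-point lemma; product/chain rules — Mathlib]
-/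

open MeasureTheory Set Metric Real Filter Topology
open Literature.Analysis.Calculus
open scoped ENNReal NNReal

set_option linter.dupNamespace false

namespace Summit.NavierStokesRegularity.NavierStokesRegularity.Theorems.PowerGaugeEulerLiouville.NeedleBandTest


/-! ## 1. The clamp `Real.smoothTransition`: vanishing derivative off `(0,1)`, a global derivative bound
(`deriv_smoothTransition_of_nonpos` / `_of_one_le` are the tree's `Literature.Analysis.Calculus.*` (…SmoothCutoff); the plate's copies and its
`hasDerivAt_smoothTransition` were removed/inlined at the gate (dedup.landed) by the firing seat — the only edits to the author's text.) -/

/-- The derivative of the clamp is globally bounded (continuous, and zero off `[0,1]`). [folklore: compactness] -/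
theorem exists_abs_deriv_smoothTransition_le :
    ∃ M : ℝ, 0 < M ∧ ∀ x : ℝ, |deriv Real.smoothTransition x| ≤ M := by
  have hc : Continuous (deriv Real.smoothTransition) :=
    (Real.smoothTransition.contDiff (n := 1)).continuous_deriv_one
  obtain ⟨M, hM⟩ := isCompact_Icc.exists_bound_of_continuousOn (hc.continuousOn (s := Icc (0 : ℝ) 1))
  refine ⟨max M 1, lt_of_lt_of_le one_pos (le_max_right _ _), fun x => ?_⟩
  by_cases h0 : x ≤ 0
  · rw [deriv_smoothTransition_of_nonpos h0, abs_zero]; exact le_trans zero_le_one (le_max_right _ _)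
  by_cases h1 : 1 ≤ x
  · rw [deriv_smoothTransition_of_one_le h1, abs_zero]; exact le_trans zero_le_one (le_max_right _ _)
  have h := hM x ⟨le_of_lt (not_le.mp h0), le_of_lt (not_le.mp h1)⟩
  rw [Real.norm_eq_abs] at h
  exact h.trans (le_max_left _ _)

/-- An absolute bound `M > 0` for `|smoothTransition'|`. -/
noncomputable def clampBound : ℝ := Classical.choose exists_abs_deriv_smoothTransition_le

/-- `0 < clampBound`. -/
theorem clampBound_pos : 0 < clampBound := (Classical.choose_spec exists_abs_deriv_smoothTransition_le).1

/-- `|smoothTransition' x| ≤ clampBound`. -/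
theorem abs_deriv_smoothTransition_le (x : ℝ) : |deriv Real.smoothTransition x| ≤ clampBound :=
  (Classical.choose_spec exists_abs_deriv_smoothTransition_le).2 x

/-! ## 2. The radial cut-off `ψ(z) = φ((r₂² − ‖z‖²)/(r₂² − r₁²))` -/

/-- Radial cut-off: `1` on `‖z‖ ≤ r₁`, `0` on `‖z‖ ≥ r₂`, smooth (a function of `‖z‖²`). -/
noncomputable def radialCutoff (r₁ r₂ : ℝ) (z : ℂ) : ℝ :=
  Real.smoothTransition ((r₂ ^ 2 - r₁ ^ 2)⁻¹ * (r₂ ^ 2 - ‖z‖ ^ 2))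

/-- `0 ≤ ψ`. -/
theorem radialCutoff_nonneg (r₁ r₂ : ℝ) (z : ℂ) : 0 ≤ radialCutoff r₁ r₂ z := Real.smoothTransition.nonneg _

/-- `ψ ≤ 1`. -/
theorem radialCutoff_le_one (r₁ r₂ : ℝ) (z : ℂ) : radialCutoff r₁ r₂ z ≤ 1 := Real.smoothTransition.le_one _

/-- `ψ = 1` on the inner disc. -/
theorem radialCutoff_eq_one {r₁ r₂ : ℝ} (h₁ : 0 < r₁) (h₁₂ : r₁ < r₂) {z : ℂ} (hz : ‖z‖ ≤ r₁) :
    radialCutoff r₁ r₂ z = 1 := by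
  apply Real.smoothTransition.one_of_one_le
  have hd : 0 < r₂ ^ 2 - r₁ ^ 2 := by nlinarith
  rw [← div_eq_inv_mul, le_div_iff₀ hd, one_mul]
  nlinarith [norm_nonneg z]

/-- `ψ = 0` off the outer disc. -/
theorem radialCutoff_eq_zero {r₁ r₂ : ℝ} (h₁ : 0 < r₁) (h₁₂ : r₁ < r₂) {z : ℂ} (hz : r₂ ≤ ‖z‖) :
    radialCutoff r₁ r₂ z = 0 := by
  apply Real.smoothTransition.zero_of_nonpos
  have hd : 0 < r₂ ^ 2 - r₁ ^ 2 := by nlinarith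
  exact mul_nonpos_of_nonneg_of_nonpos (inv_nonneg.2 hd.le) (by nlinarith [norm_nonneg z])

/-- `‖∇(‖·‖²)(z)‖ ≤ 2‖z‖`. [Mathlib `fderiv_norm_sq_apply`] -/
theorem norm_fderiv_norm_sq_le (z : ℂ) : ‖fderiv ℝ (fun w : ℂ => ‖w‖ ^ 2) z‖ ≤ 2 * ‖z‖ := by
  rw [fderiv_norm_sq_apply]
  refine norm_nsmul_le.trans (le_of_eq ?_)
  rw [innerSL_apply_norm]; norm_num

/-- The derivative of the radial cut-off. [chain rule] -/
theorem hasFDerivAt_radialCutoff (r₁ r₂ : ℝ) (z : ℂ) :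
    HasFDerivAt (radialCutoff r₁ r₂)
      (deriv Real.smoothTransition ((r₂ ^ 2 - r₁ ^ 2)⁻¹ * (r₂ ^ 2 - ‖z‖ ^ 2)) •
        ((r₂ ^ 2 - r₁ ^ 2)⁻¹ • -fderiv ℝ (fun w : ℂ => ‖w‖ ^ 2) z)) z := by
  have hD : HasFDerivAt (fun w : ℂ => ‖w‖ ^ 2) (fderiv ℝ (fun w : ℂ => ‖w‖ ^ 2) z) z :=
    (hasStrictFDerivAt_norm_sq z).hasFDerivAt.differentiableAt.hasFDerivAt
  have hg : HasFDerivAt (fun w : ℂ => (r₂ ^ 2 - r₁ ^ 2)⁻¹ * (r₂ ^ 2 - ‖w‖ ^ 2))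
      ((r₂ ^ 2 - r₁ ^ 2)⁻¹ • -fderiv ℝ (fun w : ℂ => ‖w‖ ^ 2) z) z :=
    (hD.const_sub (r₂ ^ 2)).const_mul _
  exact (((Real.smoothTransition.contDiff (n := 1)).differentiable (by simp) _).hasDerivAt).comp_hasFDerivAt z hg

/-- The cut-off gradient is `≤ 2M/(r₂ − r₁)` and vanishes off the disc `‖z‖ < r₂`. -/
theorem norm_fderiv_radialCutoff_le {r₁ r₂ : ℝ} (h₁ : 0 < r₁) (h₁₂ : r₁ < r₂) (z : ℂ) :
    ‖fderiv ℝ (radialCutoff r₁ r₂) z‖ ≤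
      if ‖z‖ < r₂ then 2 * clampBound / (r₂ - r₁) else 0 := by
  rw [(hasFDerivAt_radialCutoff r₁ r₂ z).fderiv]
  have hd : 0 < r₂ ^ 2 - r₁ ^ 2 := by nlinarith
  have hM := clampBound_pos
  split_ifs with hz
  · rw [norm_smul, norm_smul, norm_neg, Real.norm_eq_abs, Real.norm_eq_abs, abs_of_pos (inv_pos.2 hd)]
    calc |deriv Real.smoothTransition ((r₂ ^ 2 - r₁ ^ 2)⁻¹ * (r₂ ^ 2 - ‖z‖ ^ 2))| *
          ((r₂ ^ 2 - r₁ ^ 2)⁻¹ * ‖fderiv ℝ (fun w : ℂ => ‖w‖ ^ 2) z‖)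
        ≤ clampBound * ((r₂ ^ 2 - r₁ ^ 2)⁻¹ * (2 * r₂)) := by
          gcongr
          · exact abs_deriv_smoothTransition_le _
          · exact (norm_fderiv_norm_sq_le z).trans (by linarith [hz.le])
      _ = 2 * clampBound / (r₂ - r₁) * (r₂ / (r₂ + r₁)) := by
          have : r₂ ^ 2 - r₁ ^ 2 = (r₂ - r₁) * (r₂ + r₁) := by ring
          rw [this]; field_simp
      _ ≤ 2 * clampBound / (r₂ - r₁) := by
          apply mul_le_of_le_one_right (div_nonneg (by positivity) (by linarith))
          rw [div_le_one (by linarith)]; linarith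
  · rw [deriv_smoothTransition_of_nonpos
      (mul_nonpos_of_nonneg_of_nonpos (inv_nonneg.2 hd.le) (by nlinarith [norm_nonneg z, not_lt.mp hz])),
      zero_smul, norm_zero]

/-! ## 3. The test function `u = ψ · φ((F − a)/(b − a))` and the one-band law -/

variable {F : ℂ → ℝ} {F' : ℂ → ℂ →L[ℝ] ℝ} {r r₁ r₂ a b : ℝ}

/-- The super-level set `{‖z‖ < ρ, F > ℓ}` of `F` in the open disc of radius `ρ`. -/
def levSet (F : ℂ → ℝ) (ρ ℓ : ℝ) : Set ℂ := {z | ‖z‖ < ρ ∧ ℓ < F z}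

/-- The level band `{‖z‖ < ρ, ℓ < F < ℓ'}`. -/
def bandSet (F : ℂ → ℝ) (ρ ℓ ℓ' : ℝ) : Set ℂ := {z | ‖z‖ < ρ ∧ ℓ < F z ∧ F z < ℓ'}

/-- Membership in `levSet`. -/
@[simp] theorem mem_levSet {F : ℂ → ℝ} {ρ ℓ : ℝ} {z : ℂ} : z ∈ levSet F ρ ℓ ↔ ‖z‖ < ρ ∧ ℓ < F z := Iff.rfl

/-- Membership in `bandSet`. -/
@[simp] theorem mem_bandSet {F : ℂ → ℝ} {ρ ℓ ℓ' : ℝ} {z : ℂ} :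
    z ∈ bandSet F ρ ℓ ℓ' ↔ ‖z‖ < ρ ∧ ℓ < F z ∧ F z < ℓ' := Iff.rfl

/-- Super-level sets of `F` in an open disc are measurable (open). -/
theorem measurableSet_levSet (hFc : Continuous F) (ρ ℓ : ℝ) : MeasurableSet (levSet F ρ ℓ) :=
  ((isOpen_lt continuous_norm continuous_const).inter (isOpen_lt continuous_const hFc)).measurableSet

/-- Level bands of `F` in an open disc are measurable (open). -/
theorem measurableSet_bandSet (hFc : Continuous F) (ρ ℓ ℓ' : ℝ) : MeasurableSet (bandSet F ρ ℓ ℓ') :=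
  ((isOpen_lt continuous_norm continuous_const).inter
    ((isOpen_lt continuous_const hFc).inter (isOpen_lt hFc continuous_const))).measurableSet


/-- The band test function `u = ψ · φ((b − a)⁻¹ (F − a))`: `= 1` on `{‖z‖ ≤ r₁, F ≥ b}`, `= 0` off `{‖z‖ < r₂, F > a}`. -/
noncomputable def bandTest (F : ℂ → ℝ) (a b r₁ r₂ : ℝ) (z : ℂ) : ℝ :=
  radialCutoff r₁ r₂ z * Real.smoothTransition ((b - a)⁻¹ * (F z - a))

/-- The derivative of the band test function inside `ball 0 r`. [product and chain rules] -/
theorem hasFDerivAt_bandTest (hF : ∀ z ∈ ball (0 : ℂ) r, HasFDerivAt F (F' z) z) {z : ℂ}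
    (hz : z ∈ ball (0 : ℂ) r) :
    HasFDerivAt (bandTest F a b r₁ r₂)
      (radialCutoff r₁ r₂ z • (deriv Real.smoothTransition ((b - a)⁻¹ * (F z - a)) • ((b - a)⁻¹ • F' z)) +
        Real.smoothTransition ((b - a)⁻¹ * (F z - a)) • fderiv ℝ (radialCutoff r₁ r₂) z) z := by
  have hg : HasFDerivAt (fun w => (b - a)⁻¹ * (F w - a)) ((b - a)⁻¹ • F' z) z :=
    ((hF z hz).sub_const a).const_mul (b - a)⁻¹
  have hφ := (((Real.smoothTransition.contDiff (n := 1)).differentiable (by simp) _).hasDerivAt).comp_hasFDerivAt z hg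
  have hψ : HasFDerivAt (radialCutoff r₁ r₂) (fderiv ℝ (radialCutoff r₁ r₂) z) z :=
    (hasFDerivAt_radialCutoff r₁ r₂ z).differentiableAt.hasFDerivAt
  exact hψ.mul hφ

/-- `u` vanishes off the closed disc of radius `r₂`. -/
theorem bandTest_eq_zero_of_le (h₁ : 0 < r₁) (h₁₂ : r₁ < r₂) {z : ℂ} (hz : r₂ ≤ ‖z‖) :
    bandTest F a b r₁ r₂ z = 0 := by
  rw [bandTest, radialCutoff_eq_zero h₁ h₁₂ hz, zero_mul]

/-- `u = 1` on `{‖z‖ ≤ r₁, b ≤ F}`. -/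
theorem bandTest_eq_one (h₁ : 0 < r₁) (h₁₂ : r₁ < r₂) (hab : a < b) {z : ℂ} (hz : ‖z‖ ≤ r₁) (hFz : b ≤ F z) :
    bandTest F a b r₁ r₂ z = 1 := by
  rw [bandTest, radialCutoff_eq_one h₁ h₁₂ hz, one_mul]
  apply Real.smoothTransition.one_of_one_le
  rw [← div_eq_inv_mul, le_div_iff₀ (by linarith)]
  linarith

/-- `u` is `C¹` on `ℂ` when `F` is `C¹` on `ball 0 r ⊃ closedBall 0 r₂`. [product/chain rules; locally zero outside] -/
theorem contDiff_bandTest (hF : ∀ z ∈ ball (0 : ℂ) r, HasFDerivAt F (F' z) z)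
    (hF'c : ContinuousOn F' (ball (0 : ℂ) r)) (h₁ : 0 < r₁) (h₁₂ : r₁ < r₂) (h₂r : r₂ < r) :
    ContDiff ℝ 1 (bandTest F a b r₁ r₂) := by
  rw [contDiff_iff_contDiffAt]
  intro z
  by_cases hz : z ∈ ball (0 : ℂ) r
  · have hFz : ContDiffAt ℝ 1 F z := by
      rw [contDiffAt_one_iff]
      exact ⟨F', ball 0 r, isOpen_ball.mem_nhds hz, hF'c, hF⟩
    have hψ : ContDiffAt ℝ 1 (radialCutoff r₁ r₂) z :=
      ((Real.smoothTransition.contDiff (n := 1)).comp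
        (contDiff_const.mul (contDiff_const.sub (contDiff_norm_sq ℝ)))).contDiffAt
    have hφ : ContDiffAt ℝ 1 (fun w => Real.smoothTransition ((b - a)⁻¹ * (F w - a))) z :=
      Real.smoothTransition.contDiffAt.comp z ((contDiffAt_const.mul (hFz.sub contDiffAt_const)))
    exact hψ.mul hφ
  · have hzr : r ≤ ‖z‖ := by simpa [mem_ball_zero_iff] using hz
    have hev : bandTest F a b r₁ r₂ =ᶠ[𝓝 z] fun _ => 0 := by
      have hopen : IsOpen {w : ℂ | r₂ < ‖w‖} := isOpen_lt continuous_const continuous_norm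
      filter_upwards [hopen.mem_nhds (show r₂ < ‖z‖ by simpa using lt_of_lt_of_le h₂r hzr)] with w hw
      exact bandTest_eq_zero_of_le h₁ h₁₂ (le_of_lt hw)
    exact (contDiffAt_const (c := (0 : ℝ))).congr_of_eventuallyEq hev

/-- `u` has compact support (inside `closedBall 0 r₂`). -/
theorem hasCompactSupport_bandTest (h₁ : 0 < r₁) (h₁₂ : r₁ < r₂) :
    HasCompactSupport (bandTest F a b r₁ r₂) := by
  apply HasCompactSupport.intro (isCompact_closedBall (0 : ℂ) r₂)
  intro z hz
  rw [mem_closedBall_zero_iff, not_le] at hz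
  exact bandTest_eq_zero_of_le h₁ h₁₂ hz.le

/-- Pointwise gradient bound: `‖∇u‖ ≤ (2M/(r₂−r₁))·𝟙{‖z‖<r₂, F>a} + (M/(b−a))‖F'‖·𝟙{‖z‖<r₂, a<F<b}`. -/
theorem norm_fderiv_bandTest_le (hF : ∀ z ∈ ball (0 : ℂ) r, HasFDerivAt F (F' z) z)
    (h₁ : 0 < r₁) (h₁₂ : r₁ < r₂) (h₂r : r₂ < r) (hab : a < b) (z : ℂ) :
    ‖fderiv ℝ (bandTest F a b r₁ r₂) z‖ ≤
      (levSet F r₂ a).indicator (fun _ => 2 * clampBound / (r₂ - r₁)) z +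
        (bandSet F r₂ a b).indicator (fun w => clampBound / (b - a) * ‖F' w‖) z := by
  have hM := clampBound_pos
  by_cases hzr : z ∈ ball (0 : ℂ) r
  · rw [(hasFDerivAt_bandTest hF hzr).fderiv]
    refine (norm_add_le _ _).trans ?_
    rw [add_comm]
    gcongr
    · -- the cut-off term
      rw [norm_smul, Real.norm_eq_abs]
      by_cases hFa : a < F z
      · by_cases hz₂ : ‖z‖ < r₂
        · rw [indicator_of_mem (show z ∈ levSet F r₂ a from mem_levSet.2 ⟨hz₂, hFa⟩)]
          calc |Real.smoothTransition ((b - a)⁻¹ * (F z - a))| * ‖fderiv ℝ (radialCutoff r₁ r₂) z‖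
              ≤ 1 * (2 * clampBound / (r₂ - r₁)) := by
                gcongr
                · rw [abs_of_nonneg (Real.smoothTransition.nonneg _)]
                  exact Real.smoothTransition.le_one _
                · have h := norm_fderiv_radialCutoff_le h₁ h₁₂ z
                  rwa [if_pos hz₂] at h
            _ = 2 * clampBound / (r₂ - r₁) := one_mul _
        · have h := norm_fderiv_radialCutoff_le h₁ h₁₂ z
          rw [if_neg hz₂] at h
          rw [le_antisymm h (norm_nonneg _), mul_zero]
          exact indicator_nonneg (fun _ _ => div_nonneg (by linarith) (by linarith)) _
      · have : Real.smoothTransition ((b - a)⁻¹ * (F z - a)) = 0 :=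
          Real.smoothTransition.zero_of_nonpos
            (mul_nonpos_of_nonneg_of_nonpos (inv_nonneg.2 (by linarith)) (by linarith))
        rw [this, abs_zero, zero_mul]
        exact indicator_nonneg (fun _ _ => div_nonneg (by linarith) (by linarith)) _
    · -- the clamp term
      rw [norm_smul, norm_smul, norm_smul, Real.norm_eq_abs, Real.norm_eq_abs, Real.norm_eq_abs,
        abs_of_nonneg (radialCutoff_nonneg _ _ _), abs_of_pos (inv_pos.2 (sub_pos.2 hab))]
      by_cases hband : a < F z ∧ F z < b
      · by_cases hz₂ : ‖z‖ < r₂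
        · rw [indicator_of_mem (show z ∈ bandSet F r₂ a b from mem_bandSet.2 ⟨hz₂, hband⟩)]
          calc radialCutoff r₁ r₂ z * (|deriv Real.smoothTransition ((b - a)⁻¹ * (F z - a))| *
                ((b - a)⁻¹ * ‖F' z‖))
              ≤ 1 * (clampBound * ((b - a)⁻¹ * ‖F' z‖)) := by
                gcongr
                · exact radialCutoff_le_one _ _ _
                · exact abs_deriv_smoothTransition_le _
            _ = clampBound / (b - a) * ‖F' z‖ := by rw [div_eq_mul_inv]; ring
        · rw [radialCutoff_eq_zero h₁ h₁₂ (not_lt.mp hz₂), zero_mul]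
          exact indicator_nonneg (fun _ _ => mul_nonneg (div_nonneg hM.le (by linarith)) (norm_nonneg _)) _
      · have h0 : deriv Real.smoothTransition ((b - a)⁻¹ * (F z - a)) = 0 := by
          rcases not_and_or.mp hband with hle | hge
          · exact deriv_smoothTransition_of_nonpos
              (mul_nonpos_of_nonneg_of_nonpos (inv_nonneg.2 (by linarith)) (by linarith [not_lt.mp hle]))
          · apply deriv_smoothTransition_of_one_le
            rw [← div_eq_inv_mul, le_div_iff₀ (sub_pos.2 hab)]
            linarith [not_lt.mp hge]
        rw [h0, abs_zero, zero_mul, mul_zero]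
        exact indicator_nonneg (fun _ _ => mul_nonneg (div_nonneg hM.le (by linarith)) (norm_nonneg _)) _
  · have hzr' : r ≤ ‖z‖ := by simpa [mem_ball_zero_iff] using hzr
    have hev : bandTest F a b r₁ r₂ =ᶠ[𝓝 z] fun _ => 0 := by
      have hopen : IsOpen {w : ℂ | r₂ < ‖w‖} := isOpen_lt continuous_const continuous_norm
      filter_upwards [hopen.mem_nhds (show r₂ < ‖z‖ from lt_of_lt_of_le h₂r hzr')] with w hw
      exact bandTest_eq_zero_of_le h₁ h₁₂ (le_of_lt hw)
    rw [hev.fderiv_eq, fderiv_const_apply, norm_zero]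
    exact add_nonneg (indicator_nonneg (fun _ _ => div_nonneg (by linarith) (by linarith)) _)
      (indicator_nonneg (fun _ _ => mul_nonneg (div_nonneg hM.le (by linarith)) (norm_nonneg _)) _)

end Summit.NavierStokesRegularity.NavierStokesRegularity.Theorems.PowerGaugeEulerLiouville.NeedleBandTest
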